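import Summits.QuantumFields.YangMills.Theorems.BalabanUVNodesN15KingModelNestedSliceSums
import Summits.QuantumFields.YangMills.Theorems.BalabanUVNodesN15KingModelGraphPowerCountingSubgraphs

/-!
# BalabanUVNodes ∕ N15 — THE KING-MODEL RUNG (PART Ε): **TWO LETTERS OF KING 1986 §3.5 IN THE POWER-COUNTING CURRENCY** — (i) the LOGARITHM: nested slice sums
# whose partial degrees are only NON-NEGATIVE are bounded by the geometric constants at the positive steps and a factor `K + 1` (the number of scales,
# `= log_L(η⁻¹) + 1`) at each zero step — «the graph is bounded as before, with the possible addition of some power of ln(L^kε)⁻¹» ((3.79)–(3.80)); (ii) the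
# SUBTRACTION: raising the exponent of one line by `r` (King: the Hölder remainder `|x − y|^{1+α}` of (3.83)–(3.85)) raises the degree of every sub-line-set through
# that line by `r` and leaves the others unchanged, so it cures exactly the divergent subgraphs through that line whose degree exceeded `−r`
# (Track A, DAG node N15 = NE2; FAN-OUT v1.1 §N15 s3 «KING-MODEL RUNG … NE2's analogue DECIDED in the model»)

HONEST FRAMING.  Count-neutral (cell `pub-ymgap`, seat `pub-ymgap-dag-n15-e` g28; `--supports stmt-QuantumFields-27366 --as helper` = K3⁸
`SpineGivenEndpointR13SepCoPHV`).  TEMPLATE LITERATURE: C. King, *The U(1) Higgs model. I. The continuum limit*, Commun. Math. Phys. **102** (1986) 649–677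
[King1986], §3.5 pp. 666–667.  Part Ι-g ★★★ `nestedSliceSum_le` bounds King's nested slice sums under POSITIVE partial degrees by `degConst·(L^bη)^{D}`,
uniformly in the number of scales; parts Δ-a–Δ-c reduced (3.77) to the subgraph condition `PosSubgraphsBy`.  §3.5 adds two elementary mechanisms, typed here
as letters: the zero-degree steps of (3.78) («D(H_{m_{i+1}}) ≥ D(H_{m_i})», equality allowed) cost a logarithm each, and the renormalisation subtraction
(3.83)–(3.85) raises a line's power by `1 + α`, curing the subgraphs through it.  Generic real analysis ∕ finite combinatorics; King's U(1)∕`A = 0` model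
bookkeeping; the CANCELLATIONS themselves (which graphs combine, [Ba3]) are NOT typed; NOT Bałaban's `G(U)`; NOT a node discharge; nothing continuum ∕ ℝ⁴ ∕ OS ∕
mass-gap ∕ Clay.  0 `sorry`; standard axioms.
THE PRINT.  p. 666 [PDF 18]: *«(ii) for m₁ < m, and some {m_i} with m₁ < m₂ < … < m_n = m, D(H_{m_i+l}) > D(H_{m_i}) … D(H_{m_{i+1}}) ≥ D(H_{m_i}) (3.78) … we shrink
lines until H_{m₁} is one vertex, leaving the sum Σ_{j=0}^{k} (L^{−j})^{D(H_{m₁})}·C. (3.79) Continuing the procedure, we shrink lines until H_{m₂} is one vertex … We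
get a similar bound for each m_i … Therefore the graph H_ren is bounded as before, with the possible addition of some power of ln(L^kε)^{−1}.»*; p. 667 [PDF 19]:
*«φ(y) = φ(x) + Σ_μ (y − x)_μ (∂_μφ)(x) + … (3.83) … The factor |x − y|^{1+α} means that the last graph in (3.84) has degree +α, and so it is convergent.»*
WHAT THIS FILE PROVES.
* §1 (ns `…Curved`, generic): `NonnegDegrees` (every partial degree `≥ 0`), `nonnegDegrees_of_posDegrees`, `degConstLog L K es` (`Π_i c_i`, `c_i = (1 − L^{−D_i})^{−1}`
  if `D_i > 0`, `K + 1` if `D_i = 0`), `stepConstLog_pos`, `degConstLog_pos`, `slice_le_slice` (`L^jη ≤ L^bη` for `j ≤ b`), ★ `sliceSum_upTo_le_log` (ONE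
  ZERO-DEGREE STEP: `Σ_{j≤b} (L^jη)^D ≤ (b+1)(L^bη)^D ≤ (K+1)(L^bη)^D` for `D ≥ 0`), ★★ **`nestedSliceSum_le_log`** (NON-NEGATIVE partial degrees ⇒ `nestedSliceSum L K
  es b ≤ degConstLog L K es·(L^bη)^{ΣD}`), ★★ `nestedSliceSum_le_degConstLog` (`≤ degConstLog`, the slice length being `≤ 1`), `PosDegreesAtLeast δ` (every POSITIVE
  partial degree is `≥ δ`; integer exponents: `δ = 1`), ★ `degConstLog_le_pow` (`≤ (max ((1 − L^{−δ})^{−1}) (K+1))^{|es|}`), ★ `nestedSliceSum_le_pow_scales` (the two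
  combined: `nestedSliceSum ≤ (max ((1 − L^{−δ})^{−1}) (K+1))^{|es|}` — at most one factor «number of scales» per line, «some power of ln(L^kε)^{−1}»).
* §2 (ns `…Graph`, generic): `subDeg_mono_exp`, ★ `posSubgraphsBy_mono_exp` (raising exponents keeps the subgraph condition), `subDeg_update_of_mem`∕`_of_not_mem`
  (raising ONE line's exponent by `r` adds `r` to the degree of the line sets through it, nothing to the others), ★★ **`posSubgraphsBy_update_of_raise`** (if the
  connected sub-line-sets avoiding `ℓ₀` have degree `> γ₁` and those through `ℓ₀` have degree `> γ₁ − r`, then after raising `e_{ℓ₀}` by `r ≥ 0` ALL have degree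
  `> γ₁` — King's «degree +α, and so it is convergent»).
HONEST SCOPE.  Letters only: which subgraphs are divergent in King's model, how the counterterm graphs pair with them, and the Hölder estimate (3.85) itself are NOT
typed ([Ba3]); the two-regime constraint (3.76) is not modelled beyond «zero steps cost `K + 1`».  Locators: [King1986] (3.78)–(3.80) p.666, (3.83)–(3.85) p.667.
-/
noncomputable section

namespace Summit.QuantumFields.YangMills.BalabanUVNodes.N15KingModelRung.Curved

open scoped BigOperators
open Finset
open Literature.MathematicalPhysics.QuantumFieldTheory.King1986.ContinuumLimit (eps)

variable (L : ℕ)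

/-! ## §1 The logarithm: nested slice sums under NON-NEGATIVE partial degrees -/

section LogRegime

omit L in
/-- **EVERY PARTIAL DEGREE IS NON-NEGATIVE** (zero allowed: King's (3.78) «D(H_{m_{i+1}}) ≥ D(H_{m_i})» read on the differences). [cite: King1986, (3.78) p.666] -/
def NonnegDegrees : List ℝ → Prop
  | [] => True
  | e :: es => 0 ≤ e + es.sum ∧ NonnegDegrees es

omit L in
/-- positive degrees are non-negative. [folklore] -/
theorem nonnegDegrees_of_posDegrees : ∀ {es : List ℝ}, PosDegrees es → NonnegDegrees es
  | [], _ => trivial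
  | _ :: _, h => ⟨h.1.le, nonnegDegrees_of_posDegrees h.2⟩

/-- **THE CONSTANT WITH LOGARITHMS**: one geometric constant `(1 − L^{−D_i})^{−1}` per POSITIVE step, one factor `K + 1` (the number of scales) per ZERO step.
[cite: King1986, (3.79)–(3.80) p.666 («with the possible addition of some power of ln(L^kε)^{−1}»)] -/
def degConstLog (K : ℕ) : List ℝ → ℝ
  | [] => 1
  | e :: es => (if 0 < e + es.sum then (1 - (L : ℝ) ^ (-(e + es.sum)))⁻¹ else ((K : ℝ) + 1)) * degConstLog K es

/-- the one-step constant is positive (`L ≥ 2`). [folklore] -/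
theorem stepConstLog_pos (hL : 2 ≤ L) (K : ℕ) (D : ℝ) : 0 < (if 0 < D then (1 - (L : ℝ) ^ (-D))⁻¹ else ((K : ℝ) + 1)) := by
  split_ifs with hD
  · obtain ⟨-, hx1, -⟩ := sliceBase_lt_one hL hD
    exact inv_pos.2 (by linarith)
  · positivity

/-- the constant is positive. [folklore] -/
theorem degConstLog_pos (hL : 2 ≤ L) (K : ℕ) : ∀ es : List ℝ, 0 < degConstLog L K es
  | [] => zero_lt_one
  | e :: es => by
      unfold degConstLog
      exact mul_pos (stepConstLog_pos L hL K _) (degConstLog_pos hL K es)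

/-- slices grow with the index: `L^jη ≤ L^bη` for `j ≤ b` (`L ≥ 1`). [folklore] -/
theorem slice_le_slice (hL : 1 ≤ L) (K : ℕ) {j b : ℕ} (hjb : j ≤ b) : (L : ℝ) ^ j * eps L K ≤ (L : ℝ) ^ b * eps L K := by
  have hL1 : (1 : ℝ) ≤ L := by exact_mod_cast hL
  have he : 0 ≤ eps L K := by unfold eps; positivity
  exact mul_le_mul_of_nonneg_right (pow_le_pow_right₀ hL1 hjb) he

/-- ★ **ONE ZERO-DEGREE STEP COSTS THE NUMBER OF SCALES**: for `D ≥ 0` and `b ≤ K`, `Σ_{j ≤ b} (L^jη)^D ≤ (K + 1)·(L^bη)^D` (each of the `b + 1 ≤ K + 1` terms is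
at most the last). [cite: King1986, (3.79)–(3.80) p.666] -/
theorem sliceSum_upTo_le_log (hL : 1 ≤ L) {D : ℝ} (hD : 0 ≤ D) {K b : ℕ} (hb : b ≤ K) :
    ∑ j ∈ Finset.range (b + 1), ((L : ℝ) ^ j * eps L K) ^ D ≤ ((K : ℝ) + 1) * ((L : ℝ) ^ b * eps L K) ^ D := by
  have hs0 : ∀ j : ℕ, 0 ≤ (L : ℝ) ^ j * eps L K := fun j => by unfold eps; positivity
  calc ∑ j ∈ Finset.range (b + 1), ((L : ℝ) ^ j * eps L K) ^ D ≤ ∑ j ∈ Finset.range (b + 1), ((L : ℝ) ^ b * eps L K) ^ D :=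
        sum_le_sum fun j hj => Real.rpow_le_rpow (hs0 j) (slice_le_slice L hL K (by have := mem_range.1 hj; omega)) hD
    _ = ((b : ℝ) + 1) * ((L : ℝ) ^ b * eps L K) ^ D := by rw [sum_const, card_range, nsmul_eq_mul]; push_cast; ring
    _ ≤ ((K : ℝ) + 1) * ((L : ℝ) ^ b * eps L K) ^ D := by
        have hbK' : (b : ℝ) ≤ K := by exact_mod_cast hb
        have hbK : (b : ℝ) + 1 ≤ (K : ℝ) + 1 := by linarith
        exact mul_le_mul_of_nonneg_right hbK (Real.rpow_nonneg (hs0 b) _)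

/-- ★★ **KING's (3.69)–(3.70) ITERATED WITH ZERO STEPS ALLOWED — THE LOGARITHMS OF (3.78)–(3.80)**: if every partial degree is NON-NEGATIVE, then for `b ≤ K`
`nestedSliceSum L K es b ≤ degConstLog L K es·(L^bη)^{es.sum}` — at a positive step the geometric constant of part Ι-g, at a zero step the factor `K + 1`.
[cite: King1986, (3.78)–(3.80) p.666 («bounded as before, with the possible addition of some power of ln(L^kε)^{−1}»)] -/
theorem nestedSliceSum_le_log (hL : 2 ≤ L) (K : ℕ) : ∀ {es : List ℝ}, NonnegDegrees es → ∀ {b : ℕ}, b ≤ K →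
    nestedSliceSum L K es b ≤ degConstLog L K es * ((L : ℝ) ^ b * eps L K) ^ es.sum
  | [], _, b, _ => by simp [nestedSliceSum, degConstLog]
  | e :: es, h, b, hb => by
      have hs : ∀ j : ℕ, 0 < (L : ℝ) ^ j * eps L K := fun j => by unfold eps; positivity
      have hdc : 0 ≤ degConstLog L K es := (degConstLog_pos L hL K es).le
      unfold nestedSliceSum degConstLog
      rw [List.sum_cons]
      calc ∑ j ∈ Finset.range (b + 1), ((L : ℝ) ^ j * eps L K) ^ e * nestedSliceSum L K es j
          ≤ ∑ j ∈ Finset.range (b + 1), ((L : ℝ) ^ j * eps L K) ^ e * (degConstLog L K es * ((L : ℝ) ^ j * eps L K) ^ es.sum) :=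
            sum_le_sum fun j hj => mul_le_mul_of_nonneg_left
              (nestedSliceSum_le_log hL K h.2 (show j ≤ K by have := mem_range.1 hj; omega)) (Real.rpow_nonneg (hs j).le _)
        _ = degConstLog L K es * ∑ j ∈ Finset.range (b + 1), ((L : ℝ) ^ j * eps L K) ^ (e + es.sum) := by
            rw [mul_sum]
            refine sum_congr rfl fun j _ => ?_
            rw [Real.rpow_add (hs j)]; ring
        _ ≤ degConstLog L K es * ((if 0 < e + es.sum then (1 - (L : ℝ) ^ (-(e + es.sum)))⁻¹ else ((K : ℝ) + 1)) * ((L : ℝ) ^ b * eps L K) ^ (e + es.sum)) := by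
            refine mul_le_mul_of_nonneg_left ?_ hdc
            split_ifs with hD
            · exact sliceSum_upTo_le L hL hD hb
            · exact sliceSum_upTo_le_log L (by omega) h.1 hb
        _ = (if 0 < e + es.sum then (1 - (L : ℝ) ^ (-(e + es.sum)))⁻¹ else ((K : ℝ) + 1)) * degConstLog L K es
              * ((L : ℝ) ^ b * eps L K) ^ (e + es.sum) := by ring

/-- ★★ **UNIFORMLY UP TO LOGARITHMS**: under non-negative partial degrees, `nestedSliceSum L K es b ≤ degConstLog L K es` for every `b ≤ K` (the slice length
`L^bη ≤ 1`, the total degree `≥ 0`). [cite: King1986, (3.79)–(3.80) p.666] -/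
theorem nestedSliceSum_le_degConstLog (hL : 2 ≤ L) (K : ℕ) {es : List ℝ} (h : NonnegDegrees es) {b : ℕ} (hb : b ≤ K) :
    nestedSliceSum L K es b ≤ degConstLog L K es := by
  have hL1 : (1 : ℝ) ≤ L := by exact_mod_cast (show 1 ≤ L by omega)
  have hdc : 0 ≤ degConstLog L K es := (degConstLog_pos L hL K es).le
  refine (nestedSliceSum_le_log L hL K h hb).trans (mul_le_of_le_one_right hdc ?_)
  have hsle : (L : ℝ) ^ b * eps L K ≤ 1 := by
    unfold eps
    rw [← div_eq_mul_inv, div_le_one (by positivity)]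
    exact pow_le_pow_right₀ hL1 hb
  have hs0 : 0 ≤ (L : ℝ) ^ b * eps L K := by unfold eps; positivity
  rcases es with _ | ⟨e, es⟩
  · simp
  · exact Real.rpow_le_one hs0 hsle (by have := h.1; rw [List.sum_cons]; exact this)

omit L in
/-- every POSITIVE partial degree is at least `δ` (the zero ones are allowed) — e.g. integer exponents with `δ = 1`. [cite: King1986, (3.78) p.666] -/
def PosDegreesAtLeast (δ : ℝ) : List ℝ → Prop
  | [] => True
  | e :: es => (0 < e + es.sum → δ ≤ e + es.sum) ∧ PosDegreesAtLeast δ es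

/-- ★ **«SOME POWER OF ln(L^kε)^{−1}»**: if every positive partial degree is `≥ δ > 0`, then `degConstLog L K es ≤ (max ((1 − L^{−δ})^{−1}) (K + 1))^{|es|}`.
[cite: King1986, p.666 («with the possible addition of some power of ln(L^kε)^{−1}»)] -/
theorem degConstLog_le_pow (hL : 2 ≤ L) (K : ℕ) {δ : ℝ} (hδ : 0 < δ) :
    ∀ {es : List ℝ}, PosDegreesAtLeast δ es → degConstLog L K es ≤ (max ((1 - (L : ℝ) ^ (-δ))⁻¹) ((K : ℝ) + 1)) ^ es.length
  | [], _ => by simp [degConstLog]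
  | e :: es, h => by
      have h2 := degConstLog_le_pow hL K hδ h.2
      have h0 : 0 ≤ degConstLog L K es := (degConstLog_pos L hL K es).le
      have hM0 : 0 ≤ max ((1 - (L : ℝ) ^ (-δ))⁻¹) ((K : ℝ) + 1) := le_max_of_le_right (by positivity)
      have h1 : (if 0 < e + es.sum then (1 - (L : ℝ) ^ (-(e + es.sum)))⁻¹ else ((K : ℝ) + 1)) ≤ max ((1 - (L : ℝ) ^ (-δ))⁻¹) ((K : ℝ) + 1) := by
        split_ifs with hD
        · exact (geomConst_mono L hL hδ (h.1 hD)).trans (le_max_left _ _)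
        · exact le_max_right _ _
      unfold degConstLog
      rw [List.length_cons, pow_succ, mul_comm (_ ^ es.length)]
      exact mul_le_mul h1 h2 h0 hM0

/-- ★ **THE BOUND WITH LOGARITHMS, ASSEMBLED**: non-negative partial degrees whose positive values are `≥ δ > 0` give, for every `b ≤ K`,
`nestedSliceSum L K es b ≤ (max ((1 − L^{−δ})^{−1}) (K + 1))^{|es|}` — at most one factor «number of scales» per line.
[cite: King1986, (3.78)–(3.80) p.666] -/
theorem nestedSliceSum_le_pow_scales (hL : 2 ≤ L) (K : ℕ) {δ : ℝ} (hδ : 0 < δ) {es : List ℝ} (h : NonnegDegrees es) (hδ' : PosDegreesAtLeast δ es)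
    {b : ℕ} (hb : b ≤ K) : nestedSliceSum L K es b ≤ (max ((1 - (L : ℝ) ^ (-δ))⁻¹) ((K : ℝ) + 1)) ^ es.length :=
  (nestedSliceSum_le_degConstLog L hL K h hb).trans (degConstLog_le_pow L hL K hδ hδ')

end LogRegime

end Summit.QuantumFields.YangMills.BalabanUVNodes.N15KingModelRung.Curved

/-! ## §2 The subtraction: raising one line's exponent cures the subgraphs through it -/

namespace Summit.QuantumFields.YangMills.BalabanUVNodes.N15KingModelRung.Graph

open scoped BigOperators
open Finset

section Raise
variable {nn m : ℕ} {src tgt : Fin m → Fin (nn + 1)}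

/-- larger exponents, larger degree. [cite: King1986, (3.66) p.664] -/
theorem subDeg_mono_exp (dV : ℝ) {e e' : Fin m → ℝ} {S : Finset (Fin m)} (h : ∀ ℓ ∈ S, e ℓ ≤ e' ℓ) :
    subDeg src tgt dV e S ≤ subDeg src tgt dV e' S := by
  unfold subDeg
  have hs := sum_le_sum h
  linarith

/-- ★ **RAISING EXPONENTS KEEPS KING's SUBGRAPH CONDITION** («additional convergence factors for the graphs»). [cite: King1986, p.667] -/
theorem posSubgraphsBy_mono_exp {γ₁ dV : ℝ} {e e' : Fin m → ℝ} (h : ∀ ℓ, e ℓ ≤ e' ℓ) (hpos : PosSubgraphsBy src tgt γ₁ dV e) :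
    PosSubgraphsBy src tgt γ₁ dV e' :=
  fun S hS hc => lt_of_lt_of_le (hpos S hS hc) (subDeg_mono_exp dV fun ℓ _ => h ℓ)

/-- raising the exponent of a line OF `S` by `r` adds `r` to `D(S)`. [cite: King1986, (3.66) p.664, (3.85) p.667] -/
theorem subDeg_update_of_mem (dV : ℝ) (e : Fin m → ℝ) {ℓ₀ : Fin m} (r : ℝ) {S : Finset (Fin m)} (h : ℓ₀ ∈ S) :
    subDeg src tgt dV (Function.update e ℓ₀ (e ℓ₀ + r)) S = subDeg src tgt dV e S + r := by
  unfold subDeg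
  have hsum : ∑ ℓ ∈ S, Function.update e ℓ₀ (e ℓ₀ + r) ℓ = ∑ ℓ ∈ S, e ℓ + r := by
    rw [← add_sum_erase S _ h, ← add_sum_erase S e h, Function.update_self]
    have hrest : ∑ ℓ ∈ S.erase ℓ₀, Function.update e ℓ₀ (e ℓ₀ + r) ℓ = ∑ ℓ ∈ S.erase ℓ₀, e ℓ :=
      sum_congr rfl fun ℓ hℓ => by rw [Function.update_of_ne (ne_of_mem_erase hℓ)]
    rw [hrest]; ring
  rw [hsum]; ring

/-- raising the exponent of a line NOT in `S` leaves `D(S)` unchanged. [cite: King1986, (3.66) p.664] -/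
theorem subDeg_update_of_not_mem (dV : ℝ) (e : Fin m → ℝ) {ℓ₀ : Fin m} (r : ℝ) {S : Finset (Fin m)} (h : ℓ₀ ∉ S) :
    subDeg src tgt dV (Function.update e ℓ₀ (e ℓ₀ + r)) S = subDeg src tgt dV e S := by
  unfold subDeg
  rw [sum_congr rfl fun ℓ hℓ => Function.update_of_ne (ne_of_mem_of_not_mem hℓ h) _ _]

/-- ★★ **THE SUBTRACTION CURES THE SUBGRAPHS THROUGH THE SUBTRACTED LINE**: if every non-empty connected sub-line-set avoiding `ℓ₀` has degree `> γ₁` and every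
one containing `ℓ₀` has degree `> γ₁ − r`, then after raising `e_{ℓ₀}` by `r` King's subgraph condition holds with margin `γ₁` — «the factor |x − y|^{1+α} means
that the last graph in (3.84) has degree +α, and so it is convergent» (`r = 1 + α` cures a linearly divergent subgraph). [cite: King1986, (3.83)–(3.85) p.667] -/
theorem posSubgraphsBy_update_of_raise {γ₁ dV : ℝ} {e : Fin m → ℝ} (ℓ₀ : Fin m) (r : ℝ)
    (hoff : ∀ S : Finset (Fin m), S.Nonempty → (∀ u ∈ lineVerts src tgt S, ∀ v ∈ lineVerts src tgt S, LConn src tgt S u v) →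
      ℓ₀ ∉ S → γ₁ < subDeg src tgt dV e S)
    (hon : ∀ S : Finset (Fin m), S.Nonempty → (∀ u ∈ lineVerts src tgt S, ∀ v ∈ lineVerts src tgt S, LConn src tgt S u v) →
      ℓ₀ ∈ S → γ₁ - r < subDeg src tgt dV e S) :
    PosSubgraphsBy src tgt γ₁ dV (Function.update e ℓ₀ (e ℓ₀ + r)) := by
  intro S hS hc
  by_cases h : ℓ₀ ∈ S
  · rw [subDeg_update_of_mem dV e r h]
    linarith [hon S hS hc h]
  · rw [subDeg_update_of_not_mem dV e r h]
    exact hoff S hS hc h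

end Raise

end Summit.QuantumFields.YangMills.BalabanUVNodes.N15KingModelRung.Graph

end
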